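import Summits.ResolutionOfSingularities.ResolutionOfSingularities.Theorems.FrobeniusClosingPatchingRelPerfectConeDepthSmoothConeClimb
import Summits.ResolutionOfSingularities.ResolutionOfSingularities.Theorems.FrobeniusClosingPatchingRelPerfectConeDepthLadderRung
import HarnessLib

/-!
# Crux `PatchingRelPerfect` (stmt-ResolutionOfSingularities-16161), chain W5.2 — RUNG «r-smooth-cone-ℓ» BY NAME: the CONE OVER A
# SMOOTH PLANE CURVE of ANY degree `d ≥ 2` at EVERY exceptional depth, `(N(x₀,x₁,x₂)) + 𝔪^{ℓ+d} ∈ 𝒞`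

[OURS · L1 W5.2 · rung tool] Replaces the role of NO printed item; NOT a statement of the manuscript under review; fact-free,
any characteristic, any residue field, no completeness, no coefficient field.  AI-written (AI review is weaker than expert review).

`S` regular local of dimension `4`, `x₀, …, x₃` a regular system of parameters, `N ∈ S[U₀,U₁,U₂]` a form of degree `d ≥ 2` whose
reduced plane curve `V(N̄) ⊂ ℙ²_κ` is SMOOTH with vertex-only singular affine cone — certificates on the reduced chart polynomials
`F_i` of `N(T₁,T₂,T₃)` (`ConeDepth.chartPoly`): (HV) `(T₁,T₂,T₃)^m ≤ (F₀, ∂F₀)` for some `m`; (HC) `(F_i, ∂F_i) = (1)` for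
`i ≠ 0`.  THEN for EVERY `ℓ` the member `I = (N(x₀,x₁,x₂)) + 𝔪^{ℓ+d}` lies in the companion class `𝒞` and satisfies the
blow-up-form core conclusion (`smoothConeRung_of_ringKrullDim`; core dress `atomDimFourBlowupAt_smoothCone`).  Route: g4's
vertex-blowup LADDER (`coneRung_of_ringKrullDim`, the quadric cone `x₀x₁ + x₂²`, weight `2`) with weight `d` and arbitrary
coefficients: `SmoothConeState.initial` → `SmoothConeState.companion` (each rung = `smoothCone_vertex_fibre` + `step`, the host
reproducing itself as the cone over the same curve one exceptional level up, depth dropping by `d`) → the END.  New coverage: every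
conic cone with smooth conic (in odd residue characteristic every rank-`3` quadric, incl. the ANISOTROPIC ones — see
`…SmoothConeDiag`), Fermat and elliptic cubic cones, … — hypersurface-led one-form members of every order `d` and every depth,
here FACT-FREE.

## References
* J. Kollár, *Lectures on Resolution of Singularities* (2007), 3.61, (3.111) Step 3. [Kollar2007]
* The Stacks Project, Tag 080A. [StacksProject]
* H. Matsumura, *Commutative Ring Theory*, CUP 1986, Thm. 30.3. [Matsumura1987]
-/

set_option linter.dupNamespace false

noncomputable section

open CategoryTheory CategoryTheory.Limits AlgebraicGeometry TopologicalSpace IsLocalRing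
open Literature.AlgebraicGeometry.Resolution
open Scheme.IdealSheafData
open scoped Pointwise

namespace Summit.ResolutionOfSingularities.ResolutionOfSingularities.Theorems

universe u

namespace ConeDepth

section Rung

variable {S : Type u} [CommRing S] [IsRegularLocalRing S]
  (x : Fin 4 → S) (hx : Ideal.span (Set.range x) = maximalIdeal S) (hdim : ringKrullDim S = (4 : ℕ))
  (deg : ℕ) (hdeg : 2 ≤ deg) (N : MvPolynomial (Fin 3) S) (hN : N.IsHomogeneous deg)
  (hV : ∃ m : ℕ, Ideal.span (Set.range (MvPolynomial.X : {j : Fin 4 // j ≠ (0 : Fin 4)} → _)) ^ m ≤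
    Ideal.span (insert (chartPoly (MvPolynomial.rename Fin.succ N) 0)
      (Set.range fun t => MvPolynomial.pderiv t (chartPoly (MvPolynomial.rename Fin.succ N) 0))))
  (hC : ∀ i : Fin 4, i ≠ 0 → Ideal.span (insert (chartPoly (MvPolynomial.rename Fin.succ N) i)
    (Set.range fun t => MvPolynomial.pderiv t (chartPoly (MvPolynomial.rename Fin.succ N) i))) = ⊤) (ℓ : ℕ)

include hx hdim hdeg hN hV hC in
/-- **RUNG «r-smooth-cone-ℓ», UNCONDITIONAL PACKAGE**: for `S` regular local of dimension `4`, `x` spanning `𝔪`, a form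
`N ∈ S[U₀,U₁,U₂]` of degree `d ≥ 2` with smooth reduced plane curve (certificates (HV), (HC)), `q = N(x₀,x₁,x₂)` and EVERY `ℓ`:
(1) `(q) + 𝔪^{ℓ+d} ∈ 𝒞` — an `𝔪`-primary companion `Q ⊇ 𝔪^m` with a REGULAR blowing up of `Spec S` along `I · Q`; (2) the
blow-up-form core conclusion for every `T = Bl_I Spec S`, `I = (q) + 𝔪^{ℓ+d}`.  Every characteristic, every residue field, every
degree, no completeness, fact-free. [cite: Kollar2007, 3.61 and (3.111) Step 3] [cite: StacksProject, Tag 080A] -/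
theorem smoothConeRung_of_ringKrullDim :
    (∃ (Q : Ideal S) (m : ℕ), IsLocalRing.maximalIdeal S ^ m ≤ Q ∧
      ∃ (B' : Scheme.{u}) (b : B' ⟶ Spec (.of S)),
        IsBlowup b (affineBlowup.idealSheaf
          ((Ideal.span {MvPolynomial.eval (fun k : Fin 3 => x k.castSucc) N} ⊔ maximalIdeal S ^ (ℓ + deg)) * Q)) ∧
        Scheme.IsRegular B') ∧
    (∀ (T : Scheme.{u}) (f : T ⟶ Spec (.of S)),
      IsBlowup f (affineBlowup.idealSheaf
        (Ideal.span {MvPolynomial.eval (fun k : Fin 3 => x k.castSucc) N} ⊔ maximalIdeal S ^ (ℓ + deg))) →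
      ∃ (J : T.IdealSheafData) (T' : Scheme.{u}) (π : T' ⟶ T), J ≠ ⊥ ∧
        (∀ t : T, t ∈ J.support → f.base t = IsLocalRing.closedPoint S) ∧
        IsBlowup π J ∧ Scheme.IsRegular T') := by
  have hd : (maximalIdeal S).spanFinrank = 4 := spanFinrank_maximalIdeal_eq_four hdim
  haveI : IsDomain S := isDomain_of_isRegularLocalRing S
  have h𝔪 : maximalIdeal S ≠ ⊥ := maximalIdeal_ne_bot_of_spanFinrank hd
  have hI : Ideal.span {MvPolynomial.eval (fun k : Fin 3 => x k.castSucc) N} ⊔ maximalIdeal S ^ (ℓ + deg) ≠ ⊥ := fun h =>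
    pow_ne_zero (ℓ + deg) h𝔪 (eq_bot_iff.mpr (le_sup_right.trans h.le))
  have hIm : ((affineBlowup.idealSheaf
      (Ideal.span {MvPolynomial.eval (fun k : Fin 3 => x k.castSucc) N} ⊔ maximalIdeal S ^ (ℓ + deg))).support :
      Set (Spec (.of S))) ⊆ {IsLocalRing.closedPoint S} := fun s hs =>
    Set.mem_singleton_iff.mpr (support_idealSheaf_subset_closedPoint (n := ℓ + deg) le_sup_right s hs)
  obtain ⟨z₁, h₁⟩ := SmoothConeState.initial x hx hd hdeg N hN hV hC ℓ
  have hcomp := SmoothConeState.companion hI hIm ℓ h₁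
  exact ⟨hcomp, fun T f hf => atomConclusion_of_companion' hI hcomp T f hf⟩

end Rung

/-- **The registered core's binder shape on the member `(N(x₀,x₁,x₂)) + 𝔪^{ℓ+d}`** for a form `N` of degree `d ≥ 2` with smooth
reduced plane curve (hypotheses of `stub_atomDimFourBlowup`; characteristic, completeness, perfectness of the residue field and the
off-fibre hypothesis unused). [cite: Kollar2007, 3.61] -/
theorem atomDimFourBlowupAt_smoothCone (p : ℕ) (_hp : p.Prime) (S : Type) [CommRing S]
    [IsRegularLocalRing S] [CharP S p] [IsAdicComplete (IsLocalRing.maximalIdeal S) S]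
    [PerfectField (IsLocalRing.ResidueField S)] (hS : ringKrullDim S = (4 : ℕ))
    (x : Fin 4 → S) (hx : Ideal.span (Set.range x) = IsLocalRing.maximalIdeal S)
    (deg : ℕ) (hdeg : 2 ≤ deg) (N : MvPolynomial (Fin 3) S) (hN : N.IsHomogeneous deg)
    (hV : ∃ m : ℕ, Ideal.span (Set.range (MvPolynomial.X : {j : Fin 4 // j ≠ (0 : Fin 4)} → _)) ^ m ≤
      Ideal.span (insert (chartPoly (MvPolynomial.rename Fin.succ N) 0)
        (Set.range fun t => MvPolynomial.pderiv t (chartPoly (MvPolynomial.rename Fin.succ N) 0))))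
    (hC : ∀ i : Fin 4, i ≠ 0 → Ideal.span (insert (chartPoly (MvPolynomial.rename Fin.succ N) i)
      (Set.range fun t => MvPolynomial.pderiv t (chartPoly (MvPolynomial.rename Fin.succ N) i))) = ⊤) (ℓ : ℕ)
    (T : Scheme.{0}) (f : T ⟶ Spec (.of S))
    (hf : IsBlowup f (affineBlowup.idealSheaf
      (Ideal.span {MvPolynomial.eval (fun k : Fin 3 => x k.castSucc) N} ⊔ IsLocalRing.maximalIdeal S ^ (ℓ + deg))))
    (_hoff : ∀ t : T, f.base t ≠ IsLocalRing.closedPoint S → IsRegularLocalRing (T.presheaf.stalk t)) :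
    ∃ (J : T.IdealSheafData) (T' : Scheme.{0}) (π : T' ⟶ T), J ≠ ⊥ ∧
      (∀ t : T, t ∈ J.support → f.base t = IsLocalRing.closedPoint S) ∧
      IsBlowup π J ∧ Scheme.IsRegular T' :=
  (smoothConeRung_of_ringKrullDim x hx hS deg hdeg N hN hV hC ℓ).2 T f hf

end ConeDepth

end Summit.ResolutionOfSingularities.ResolutionOfSingularities.Theorems

end
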